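import Summits.PneNP.PneNP.Theorems.OneSliceConstantBandDefs
import Summits.PneNP.PneNP.Theorems.OneSliceConstantBandSliceLemma23Moment

/-!
# Route OneSlice, crux `ConstantBand` (stmt-PneNP-2834), line `flat-prior-relative-minterms`:
# stub S1 · slice Lemma 23 (`stub_sliceLemma23`, definitionally `SliceLemma23` with `∃ L`)

The SLICE form of Rossman FOCS'10 Lemma 23 (planted `k`-clique versus uniform on one Erdős–Rényi slice,
Cauchy–Schwarz form) with a crude `k`-dependent constant: for `k ≥ 3` there is `L = L_k > 0` such that for
every width `w` and `ε > 0`, eventually in `n`, for every central `j`, every band slice `i ∈ [j-w, j+w]` and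
EVERY Boolean `f`,
`P_{x ∼ G(n,i), A}[f(x ∪ K_A) = 0] ≤ √(L · P_{y ∼ G(n,i+C(k,2))}[f(y) = 0 ∧ CLIQUE_k(y)]) + ε`.

Proof (no circuits, no monotonicity — counting on two hypergeometric slices): split the rejected planted
pairs into OVERLAP pairs (`K_A ∩ x ≠ ∅`, a `≤ C(k,2)·i/C(n,2) ≤ ε` fraction, `l23_card_overlap_le`) and
non-overlap pairs, which fibre injectively over `y = x ∪ K_A ∈ slice_{i+C(k,2)}` with `f(y) = 0`,
`CLIQUE_k(y) = 1` and multiplicity `ω_k(y)` (`l23_card_noOverlap_le`); then Cauchy–Schwarz, the second moment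
of `ω_k` on the slice and the ratio of adjacent slice sizes (`l23_fibre_bound`, helper files
`OneSliceConstantBandSliceLemma23Aux/Moment.lean`). The eventual regime in `n` is `l23_eventually_regime`
(`n ≥ 2k`, `T^{3/4} ≤ T/4`, `T ≥ 4(w + C(k,2) + 1)`, `θ ≤ 1/2`, `2C(k,2)θ ≤ ε`; `T = C(n,2)θ`,
`θ = n^{-2/(k-1)}`), unpacked on a band slice by `l23_regime_slice`. [folklore]
-/

noncomputable section

namespace Summit.PneNP.PneNP.Cruxes.ConstantBand.FlatPriorRelativeMinterms

open Literature.Computability.Complexity Filter Classical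
open Finset hiding slice

set_option linter.dupNamespace false

/-- **S1 · slice Lemma 23** (planted `k`-clique versus uniform on ONE Erdős–Rényi slice, Cauchy–Schwarz
form, with a crude constant). For `k ≥ 3` put `K = C(k,2)` and
`L_k = (1 + k·2^k·2^K) · (2^K·2^K·2^k·k!)`. Then for every width `w` and `ε > 0`, eventually in `n`: for
every central `j`, every band slice `i ∈ [j-w, j+w]` and EVERY Boolean `f`,
`P_{x ∼ G(n,i), A}[f(x ∪ K_A) = 0] ≤ √(L_k · P_{y ∼ G(n,i+K)}[f(y) = 0 ∧ CLIQUE_k(y)]) + ε`.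
Proof: the overlap pairs `K_A ∩ x ≠ ∅` are a `≤ K·i/C(n,2) ≤ ε` fraction (`l23_card_overlap_le`); off
the overlap, `(x, A) ↦ x ∪ K_A` is injective with fibres of size `ω_k(y)` over the slice `i + K`
(`l23_card_noOverlap_le`); Cauchy–Schwarz and the second moment `Σ_y ω_k(y)² ≤ #slice·C(n,k)·p^K·(1 + k2^k2^K)`
(`l23_secondMoment_le`, Rossman FOCS'10 App. B on the slice) with the slice ratio `l23_ratio_le` give the
square root (`l23_fibre_bound`). [folklore] -/
theorem stub_sliceLemma23 :
    ∀ k : ℕ, 3 ≤ k → ∃ L : ℝ, 0 < L ∧ ∀ w : ℕ, ∀ ε : ℝ, 0 < ε → ∀ᶠ n : ℕ in atTop, ∀ j : ℕ, Central k n j →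
      ∀ i ∈ band j w, ∀ f : (Edge n → Bool) → Bool,
        pairProb n k i (fun x A => f (plantClique A x) = false) ≤
          Real.sqrt (L * sliceProb n (i + k.choose 2) (fun y => f y = false ∧ cliqueFn n k y = true)) + ε := by
  intro k hk
  refine ⟨(1 + k * 2 ^ k * 2 ^ k.choose 2) * (2 ^ k.choose 2 * 2 ^ k.choose 2 * 2 ^ k * k.factorial),
    by positivity, fun w ε hε => ?_⟩
  filter_upwards [l23_eventually_regime hk w hε] with n hn j hj i hi f
  obtain ⟨h2k, h34, hTw, hhalf, hεθ⟩ := hn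
  have hN : 0 < n.choose 2 := Nat.choose_pos (by omega)
  rw [band, mem_Icc] at hi
  obtain ⟨hKi, hiN, hp, hθi, hεi⟩ := l23_regime_slice h34 hTw hhalf hεθ hN hj (by omega) hi.2
  set K := k.choose 2 with hK
  set S := slice n i with hS
  set 𝒜 := powersetCard k (univ : Finset (Fin n)) with h𝒜
  set Q := (slice n (i + K)).filter (fun y => f y = false ∧ cliqueFn n k y = true) with hQ
  have hiN' : i ≤ n.choose 2 := by omega
  have hSpos : (0 : ℝ) < #S := l23_card_slice_cast_pos hiN'
  have hC : (0 : ℝ) < n.choose k := by exact_mod_cast Nat.choose_pos (by omega)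
  have hN' : (0 : ℝ) < n.choose 2 := by exact_mod_cast hN
  -- the bad pairs split into overlap pairs and non-overlap pairs
  set B := (S ×ˢ 𝒜).filter (fun xa => f (plantClique xa.2 xa.1) = false) with hB
  set B₁ := (S ×ˢ 𝒜).filter (fun xa => ∃ e, cliqueVec xa.2 e = true ∧ xa.1 e = true) with hB₁
  set B₂ := (S ×ˢ 𝒜).filter (fun xa => f (plantClique xa.2 xa.1) = false ∧
    ∀ e, cliqueVec xa.2 e = true → xa.1 e = false) with hB₂
  have hsplit : #B ≤ #B₁ + #B₂ := by
    refine (card_le_card fun xa hxa => ?_).trans (card_union_le B₁ B₂)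
    rw [hB, mem_filter] at hxa
    rw [mem_union, hB₁, hB₂, mem_filter, mem_filter]
    by_cases h : ∃ e, cliqueVec xa.2 e = true ∧ xa.1 e = true
    · exact Or.inl ⟨hxa.1, h⟩
    · push Not at h
      refine Or.inr ⟨hxa.1, hxa.2, fun e he => ?_⟩
      simpa using h e he
  -- (2) overlap is rare
  have h1 : (#B₁ : ℝ) ≤ ε * (#S * n.choose k) := by
    have hKε : (K : ℝ) * ((i : ℝ) / n.choose 2) ≤ ε := by
      rw [mul_div_assoc', div_le_iff₀ hN']
      exact hεi
    calc (#B₁ : ℝ) ≤ n.choose k * (K * ((i : ℝ) / n.choose 2 * #S)) := l23_card_overlap_le k hiN' hN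
      _ = (K * ((i : ℝ) / n.choose 2)) * (#S * n.choose k) := by ring
      _ ≤ ε * (#S * n.choose k) := by gcongr
  -- (3) non-overlap pairs fibre over `Q`
  have h2 : (#B₂ : ℝ) ≤ ∑ y ∈ Q, (#(𝒜.filter fun A => ∀ e, cliqueVec A e = true → y e = true) : ℝ) := by
    have h := l23_card_noOverlap_le k i f (Q := Q)
      (fun y hy hf hc => by rw [hQ, mem_filter]; exact ⟨hy, hf, hc⟩)
    exact_mod_cast h
  -- (4)–(6) Cauchy–Schwarz, second moment, slice ratio
  have h3 := l23_fibre_bound (by omega) h2k hKi hiN hp hθi (filter_subset _ _ : Q ⊆ slice n (i + K))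
  -- (7) assemble
  have main : (#B : ℝ) / (#S * n.choose k) ≤
      Real.sqrt ((1 + k * 2 ^ k * 2 ^ K) * (2 ^ K * 2 ^ K * 2 ^ k * k.factorial) *
        ((#Q : ℝ) / #(slice n (i + K)))) + ε := by
    have hD : (0 : ℝ) < #S * n.choose k := mul_pos hSpos hC
    calc (#B : ℝ) / (#S * n.choose k) ≤ ((#B₁ : ℝ) + #B₂) / (#S * n.choose k) := by
          gcongr
          exact_mod_cast hsplit
      _ = (#B₂ : ℝ) / (#S * n.choose k) + (#B₁ : ℝ) / (#S * n.choose k) := by ring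
      _ ≤ (∑ y ∈ Q, (#(𝒜.filter fun A => ∀ e, cliqueVec A e = true → y e = true) : ℝ)) /
            (#S * n.choose k) + ε := by
          gcongr
          · rwa [div_le_iff₀ hD]
      _ ≤ _ := by gcongr
  simp only [pairProb, sliceProb]
  convert main using 8

end Summit.PneNP.PneNP.Cruxes.ConstantBand.FlatPriorRelativeMinterms

end
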